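import Literature.NumberTheory.EllipticCurves.PastenHeightBoundsShimuraApproachProofs
import Literature.NumberTheory.EllipticCurves.PastenValuationProductThm75Proofs
import Literature.NumberTheory.EllipticCurves.UniformizationUniqueProofs
import HarnessLib

/-!
# Pasten 2024, Thm 1.9: the classical input (EqHDeg) `h(E) ≤ ½ log δ_{1,N} + 9` discharged
# from modularity, and Thm 1.9 from modularity + Thm 6.1 + Thm 7.2

Topic `NumberTheory/EllipticCurves`; a third proofs-only sibling of `PastenHeightBounds.lean`
(theorems only: NO definition, NO named fact — D-0014/D-0026), continuing
`PastenHeightBoundsProofs.lean` (Cor 7.8 ⇐ Thm 7.7; Thm 7.7 ⇐ Thm 7.6 + Thm 7.2; Prop 7.1) and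
`PastenHeightBoundsShimuraApproachProofs.lean` (Thm 7.6, height half, ⇐ (EqHDeg) + Thm 6.1;
hence Thm 1.9 ⇐ (EqHDeg) + Thm 6.1 + Thm 7.2, `pasten2024_height_lt_of_bounds_of_thm_7_2`;
there the input (EqHDeg) is the hypothesis `h34` / the name component `eq_3_4`) towards the named
fact `pasten2024_height_lt` (H. Pasten, *Shimura curves and the abc conjecture*, J. Number Theory
254 (2024) = arXiv:1705.09251, Thm 1.9 = Cor 7.8, p. 7 / p. 27).

## What is proved here (source pp. 13 and 27 of the arXiv version, read)

Of the three inputs left open by `pasten2024_height_lt_of_bounds_of_thm_7_2` — (EqHDeg), Thm 6.1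
(EqUpperRT) and Thm 7.2 for a general admissible factorisation — the first is the **classical
modular approach** of §3 (p. 13; the source's equation labels are used throughout):

  (EqFrey) `log δ_{1,N}(E) = 2 log(2π c_f) + 2 log ‖f‖_{2,Γ₀(N)} + 2 h(A_{1,N})`,
  "`log(2π c_f) + log ‖f‖ > −6`" (the Manin constant is a positive integer; integrate `f f̄` over
  `|x| < ½, y > 1`), and `|h(A_{1,N}) − h(E)| ≤ ½ log 163 < 3` (Mazur–Kenku + Faltings' Lemma 5),
  whence **(EqHDeg)** `h(E) ≤ h(A_{1,N}) + 3 ≤ ½ log δ_{1,N} + 9`.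

All of this is available in the tree from the single named fact
`nonempty_modularParametrizationData` (modularity with an integral Manin constant: every globally
minimal elliptic `W/ℚ` carries a datum `X₀(N_W) → W` — Wiles, Taylor–Wiles, BCDT; Edixhoven), the
rest being PROVED there: Zagier's identity `4π² c² (f,f) = deg φ · covol(Λ_W)` for every datum
(`zagier_degree_formula_holds`, read as (EqFrey) with `h = −½ log covol`, packaged as
`Pasten2024.twelve_mul_neronLatticeHeight_le`), `c ≠ 0` (`maninConstant_ne_zero_holds`) and
Pasten's trivial Petersson bound `(f,f) ≥ e^{−4π}/(4π)` (`IsNewformOf.peterssonProduct_re_ge`).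
Hence, in this file:

* `neronLatticeHeight_eq_of_isNeronLatticeOf` — `h = −½ log covol(Λ)` does not depend on the
  period pair spanning the Néron lattice (uniformisation uniqueness,
  `PeriodPair.uniformization_unique_holds`);
* `pasten2024_eq_3_4_of_modularity` — **(EqHDeg) for the minimal modular degree of `W` itself**:
  `h(W) ≤ ½ log(minModularDegree W N_W) + (2π − ½ log π)` for every globally minimal elliptic
  `W/ℚ` and every Néron period pair (constant `2π − ½ log π < 5.8`; primed form with Pasten's `9`).
  Here the datum parametrises `W` itself, so the detour through the optimal quotient `A_{1,N}` is
  not needed; the price is that `minModularDegree W N_W` (Frey's minimal degree of `W`,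
  `ModularDegreeMinimal.lean`) replaces the optimal degree `δ_{1,N}` of the class;
* `pasten2024_eq_3_4_classMinimal_of_modularity_of_mazurKenku` — **(EqHDeg) verbatim**, in the
  `δ_{1,N}` idiom of `PastenSpectralDegree.lean` (`δ_{1,N}` = the modular degree of a datum of
  minimal degree among all data, of all elliptic `W'/ℚ`, with the newform of the class at level
  `N`): `h(E) ≤ ½ log δ_{1,N} + 9`, from modularity and the Mazur–Kenku comparison
  `minModularDegree ≤ 163 · δ_{1,N}` (the named fact `PastenShimura2024_minimalDegree_le_163_mul`,
  Pasten's "degree of a minimal isogeny … bounded by 163"); the constant is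
  `½ log 163 + 2π − ½ log π < 9`;
* `pasten2024_height_lt_of_modularity_of_thm_6_1_of_thm_7_2` and
  `pasten2024_height_lt_of_modularity_of_mazurKenku_of_thm_6_1_of_thm_7_2` — **Thm 1.9 from
  modularity, a Thm 6.1-type comparison and Thm 7.2**, the comparison being rendered on
  `minModularDegree W N_W`, resp. on the class-minimal degree `δ_{1,N}` (then together with the
  Mazur–Kenku fact), and Thm 7.2 (asymptotic clause, general admissible `N = DM`) over an abstract
  degree function `δ W D M` standing for `δ_{D,M}(E)` (Shimura curves `X₀^D(M)` and the optimal
  quotients `J₀^D(M) → A_{D,M}` are not in the tree, so `δ_{D,M}` cannot be named yet).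

## Status of `pasten2024_height_lt_holds`

Not here. After this file the `D = 1` side of Pasten's proof of Thm 1.9 rests on named facts that
EXIST in the tree (`nonempty_modularParametrizationData`; for the `δ_{1,N}` form also
`PastenShimura2024_minimalDegree_le_163_mul`), and exactly two inputs remain hypotheses, both about
Shimura-curve degrees `δ_{D,M}` with `D > 1`: Thm 6.1, first display (EqUpperRT,
`log δ_{1,N} ≤ log δ_{D,M} + log ∏_{p∣D} v_p(Δ_E) + 5.1 ω(D)`; refined Ribet–Takahashi), and
Thm 7.2, asymptotic clause (`log δ_{D,M} < (1/24 + ε) φ(D) M log N` for `N ≫_ε 1`; Thm 5.5 on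
`𝕋_{D,M}` + Prop 5.4 + Prop 7.1 + Atkin–Lehner/Murty). Neither is stated in the tree (no
`X₀^D(M)`, `J₀^D(M)`, `A_{D,M}`, `δ_{D,M}`, `𝕋_{D,M}`); when they are, `pasten2024_height_lt_holds`
is the one-line instantiation of either final theorem below.

## References

* [PastenShimura2024] H. Pasten, *Shimura curves and the abc conjecture*, J. Number Theory 254
  (2024) 214–335 = arXiv:1705.09251: §3 p. 13 ((EqDiscH), (EqFrey), (EqHDeg), Mazur–Kenku),
  Thm 6.1 p. 20, Thm 7.2 p. 26, Thm 7.6–7.7 and Cor 7.8 p. 27, Thm 1.9 p. 7. READ (held text).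
* [ZagierCMB1985] D. Zagier, *Modular parametrizations of elliptic curves*, Canad. Math. Bull. 28
  (1985), §1 (the degree formula; tree: `zagier_degree_formula_holds`).
* [SilvermanAEC2009] J. H. Silverman, *The Arithmetic of Elliptic Curves*, 2nd ed., Thm. VI.5.1
  (uniqueness of the lattice with given `g₂, g₃`).
-/

noncomputable section

open scoped Classical

namespace Literature.NumberTheory.EllipticCurves.ModularForms

open WeierstrassCurve CongruenceSubgroup Finset
open Literature.NumberTheory.EllipticCurves.Pasten2024

/-! ### The height does not depend on the period pair -/

/-- Equal lattices have equal covolume (the instance arguments are propositions). [folklore] -/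
private theorem covolume_congr {Λ Λ' : Submodule ℤ ℂ} [DiscreteTopology Λ] [IsZLattice ℝ Λ]
    [DiscreteTopology Λ'] [IsZLattice ℝ Λ'] (h : Λ = Λ') :
    ZLattice.covolume Λ = ZLattice.covolume Λ' := by
  subst h
  rfl

/-- **`h(E)` is well defined**: two period pairs `L, L'` of Néron type for the same model
(`IsNeronLatticeOf W L`, `IsNeronLatticeOf W L'`: `g₂ = c₄/12`, `g₃ = c₆/216`) span the same
lattice (the uniqueness half of the uniformisation theorem, the tree's PROVED
`PeriodPair.uniformization_unique_holds`; cf. `IsNeronLatticeOf.lattice_eq`), so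
`neronLatticeHeight L = −½ log covol(Λ_L) = neronLatticeHeight L'`.
[cite: SilvermanAEC2009, Thm. VI.5.1 (uniqueness)] -/
theorem neronLatticeHeight_eq_of_isNeronLatticeOf {W : WeierstrassCurve ℂ} {L L' : PeriodPair}
    (hL : IsNeronLatticeOf W L) (hL' : IsNeronLatticeOf W L') :
    neronLatticeHeight L = neronLatticeHeight L' := by
  have h : L.lattice = L'.lattice :=
    PeriodPair.uniformization_unique_holds L L' (hL.1.trans hL'.1.symm) (hL.2.trans hL'.2.symm)
  rw [neronLatticeHeight, neronLatticeHeight, covolume_congr h]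

/-! ### (EqHDeg) from modularity: `h(E) ≤ ½ log δ + O(1)` -/

/-- **Pasten's (EqHDeg) for the minimal modular degree of `W` itself, from modularity alone.** For
every globally minimal elliptic `W/ℚ` and every period pair `L` spanning its Néron lattice,
`h(E) = neronLatticeHeight L ≤ ½ log(minModularDegree W N_W) + (2π − ½ log π)`.
Printed (§3, p. 13): (EqFrey) `log δ_{1,N} = 2 log(2π c_f) + 2 log‖f‖ + 2h(A_{1,N})` and
"`log(2π c_f) + log‖f‖ > −6`", so `h(A_{1,N}) ≤ ½ log δ_{1,N} + 6`. Tree form: a datum `D` of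
`W` of minimal degree exists by `nonempty_modularParametrizationData` (`hmod`) and
`exists_modularDegree_eq_minModularDegree`; Zagier's identity solved for the covolume with
`c² ≥ 1` (`Pasten2024.twelve_mul_neronLatticeHeight_le`, PROVED) and the trivial Petersson bound
`(f,f) ≥ e^{−4π}/(4π)` (`IsNewformOf.peterssonProduct_re_ge`, PROVED) give
`12 h(D.L) ≤ 6 log deg φ_D − 6(log π − 4π)`; finally `h(L) = h(D.L)`
(`neronLatticeHeight_eq_of_isNeronLatticeOf`). [cite: PastenShimura2024, §3 p. 13, (EqFrey)–(EqHDeg)] -/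
theorem pasten2024_eq_3_4_of_modularity (hmod : nonempty_modularParametrizationData)
    (W : WeierstrassCurve ℚ) [W.IsElliptic] [W.IsGloballyMinimal] [NeZero (W.conductorNorm ℤ)]
    (L : PeriodPair) (hL : IsNeronLatticeOf (W.baseChange ℂ) L) :
    neronLatticeHeight L ≤
      Real.log (minModularDegree W (W.conductorNorm ℤ) : ℝ) / 2 +
        (2 * Real.pi - Real.log Real.pi / 2) := by
  obtain ⟨D, hDmin⟩ := exists_modularDegree_eq_minModularDegree (hmod W)
  have hc₀ : 0 < Real.exp (-(4 * Real.pi)) / (4 * Real.pi) := by positivity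
  have hP : Real.exp (-(4 * Real.pi)) / (4 * Real.pi) ≤
      (peterssonProduct (Gamma0 (W.conductorNorm ℤ)) 2 D.f D.f).re :=
    D.isNewformOf.peterssonProduct_re_ge
  have hh := twelve_mul_neronLatticeHeight_le D hc₀ hP
  rw [log_four_pi_sq_mul_trivialPeterssonConst, ModularParametrizationData.deg_eq_modularDegree,
    hDmin] at hh
  rw [neronLatticeHeight_eq_of_isNeronLatticeOf hL D.isNeronLattice]
  linarith

/-- `2π − ½ log π ≤ 9 − ½ log 163`: the absolute constant of `pasten2024_eq_3_4_of_modularity`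
leaves room for the Mazur–Kenku term `½ log 163` inside Pasten's printed `9`
(`π < 3.15`, `log π > 1` as `e < 3 < π`, `log 163 ≤ log 256 = 8 log 2 < 5.55`). [folklore] -/
theorem two_pi_sub_half_log_pi_le : 2 * Real.pi - Real.log Real.pi / 2 ≤ 9 - Real.log 163 / 2 := by
  have hπ : Real.pi < 3.15 := Real.pi_lt_d2
  have h3 : Real.exp 1 < 3 := lt_trans Real.exp_one_lt_d9 (by norm_num)
  have hlogπ : 1 < Real.log Real.pi := by
    rw [Real.lt_log_iff_exp_lt Real.pi_pos]
    exact h3.trans Real.pi_gt_three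
  have h163 : Real.log 163 ≤ 8 * Real.log 2 := by
    rw [← Real.log_rpow two_pos, Real.log_le_log_iff (by norm_num) (by positivity)]
    norm_num
  have hlog2 : Real.log 2 < 0.6931471808 := Real.log_two_lt_d9
  linarith

/-- **Pasten's (EqHDeg) with the printed constant**, minimal-degree-of-`W` form:
`h(E) ≤ ½ log(minModularDegree W N_W) + 9` for every globally minimal elliptic `W/ℚ`, from
modularity alone. [cite: PastenShimura2024, §3 p. 13, (EqHDeg)] -/
theorem pasten2024_eq_3_4_of_modularity' (hmod : nonempty_modularParametrizationData)
    (W : WeierstrassCurve ℚ) [W.IsElliptic] [W.IsGloballyMinimal] [NeZero (W.conductorNorm ℤ)]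
    (L : PeriodPair) (hL : IsNeronLatticeOf (W.baseChange ℂ) L) :
    neronLatticeHeight L ≤ Real.log (minModularDegree W (W.conductorNorm ℤ) : ℝ) / 2 + 9 := by
  have h := pasten2024_eq_3_4_of_modularity hmod W L hL
  have hc := two_pi_sub_half_log_pi_le
  have h163 : 0 ≤ Real.log 163 := Real.log_nonneg (by norm_num)
  linarith

/-- **Pasten's (EqHDeg) verbatim: `h(E) ≤ ½ log δ_{1,N} + 9`**, with `δ_{1,N}` in the idiom of
`PastenSpectralDegree.lean` — the modular degree of a datum `D₀` (of some elliptic `W₀/ℚ`, a model of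
the optimal quotient `A_{1,N}`) which is of minimal degree among ALL data at level `N = N_E`, of all
elliptic curves over `ℚ`, with the newform of the class — for every globally minimal model `W` of a
curve `E` of the class (`IsNewformOf W D₀.f`) and every Néron period pair `L` of `W`. Printed
proof: `h(E) ≤ h(A_{1,N}) + 3 ≤ ½ log δ_{1,N} + 9` (Mazur–Kenku: a minimal isogeny `A_{1,N} → E`
has degree `≤ 163`; Faltings' Lemma 5). Tree form: the minimal datum `D'` of `W` has the newform
`D₀.f` (`IsNewformOf.unique`) and `deg φ_{D'} ≤ 163 · deg φ_{D₀}` by the Mazur–Kenku named fact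
`PastenShimura2024_minimalDegree_le_163_mul` (`h163`); then `pasten2024_eq_3_4_of_modularity` and
`½ log 163 + 2π − ½ log π ≤ 9`. [cite: PastenShimura2024, §3 p. 13, (EqHDeg)] -/
theorem pasten2024_eq_3_4_classMinimal_of_modularity_of_mazurKenku
    (hmod : nonempty_modularParametrizationData)
    (h163 : PastenShimura2024_minimalDegree_le_163_mul)
    (W : WeierstrassCurve ℚ) [W.IsElliptic] [W.IsGloballyMinimal] [NeZero (W.conductorNorm ℤ)]
    (L : PeriodPair) (hL : IsNeronLatticeOf (W.baseChange ℂ) L)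
    {W₀ : WeierstrassCurve ℚ} [W₀.IsElliptic] (D₀ : ModularParametrizationData W₀ (W.conductorNorm ℤ))
    (hf : IsNewformOf W D₀.f)
    (hmin : ∀ (W'' : WeierstrassCurve ℚ) [W''.IsElliptic]
      (D'' : ModularParametrizationData W'' (W.conductorNorm ℤ)),
      D''.f = D₀.f → D₀.modularDegree ≤ D''.modularDegree) :
    neronLatticeHeight L ≤ Real.log (D₀.modularDegree : ℝ) / 2 + 9 := by
  obtain ⟨D', hD'min, hD'le⟩ := exists_minimal_datum (hmod W)
  have hf' : D'.f = D₀.f := D'.isNewformOf.unique hf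
  have hle : D'.modularDegree ≤ 163 * D₀.modularDegree :=
    h163 (W.conductorNorm ℤ) W₀ W D₀ D' hf' hmin hD'le
  have hd₀ : (0 : ℝ) < D₀.modularDegree := by exact_mod_cast D₀.deg_pos
  have hd' : (0 : ℝ) < D'.modularDegree := by exact_mod_cast D'.deg_pos
  have hlog : Real.log (minModularDegree W (W.conductorNorm ℤ) : ℝ) ≤
      Real.log 163 + Real.log (D₀.modularDegree : ℝ) := by
    rw [← hD'min, ← Real.log_mul (by norm_num) hd₀.ne']
    exact Real.log_le_log hd' (by exact_mod_cast hle)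
  have h := pasten2024_eq_3_4_of_modularity hmod W L hL
  have hc := two_pi_sub_half_log_pi_le
  linarith

/-! ### Thm 1.9 from modularity, Thm 6.1 and Thm 7.2 -/

/-- **Thm 1.9 from modularity, a Thm 6.1-type comparison on the minimal modular degree, and
Thm 7.2.** Inputs: (i) `hmod`, modularity with an integral Manin constant (the named fact
`nonempty_modularParametrizationData`), which yields (EqHDeg) (`pasten2024_eq_3_4_of_modularity`);
(ii) `h61`, Pasten's Thm 6.1, first display (EqUpperRT: `log δ_{1,N} ≤ log δ_{D,M} +
log ∏_{p∣D} v_p(Δ_E) + 5.1 ω(D)`, any constants `B, B'`), rendered with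
`δ_{1,N} ↦ minModularDegree W N_W` and an abstract Shimura-curve degree `δ W D M = δ_{D,M}(E)`;
(iii) `h72`, Thm 7.2 (asymptotic clause) for every admissible `N = DM`. Conclusion:
`pasten2024_height_lt` (Thm 1.9 = Cor 7.8), by `pasten2024_height_lt_of_bounds_of_thm_7_2`
(Thm 7.6 ⇐ (EqHDeg) + Thm 6.1 + (EqDiscH); Thm 7.7 ⇐ Thm 7.6 + Thm 7.2; Cor 7.8 ⇐ Thm 7.7).
[cite: PastenShimura2024, Thm 1.9 via §3 (EqHDeg), Thm 6.1, Thm 7.2, Thm 7.6, Thm 7.7, Cor 7.8] -/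
theorem pasten2024_height_lt_of_modularity_of_thm_6_1_of_thm_7_2
    (hmod : nonempty_modularParametrizationData)
    (δ : WeierstrassCurve ℚ → ℕ → ℕ → ℝ) (B B' : ℝ)
    (h61 : ∀ (W : WeierstrassCurve ℚ) [W.IsElliptic] [W.IsGloballyMinimal]
      [NeZero (W.conductorNorm ℤ)] (D M : ℕ),
      W.conductorNorm ℤ = D * M → Squarefree D → Even D.primeFactors.card → D.Coprime M →
        Real.log (minModularDegree W (W.conductorNorm ℤ) : ℝ) ≤ Real.log (δ W D M) +
          Real.log (∏ p ∈ D.primeFactors, ((W.minimalDiscriminantNorm ℤ).factorization p : ℝ)) +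
          B * D.primeFactors.card + B')
    (h72 : ∀ ε : ℝ, 0 < ε → ∃ N₂ : ℕ,
      ∀ (W : WeierstrassCurve ℚ) [W.IsElliptic],
        ∀ D M : ℕ, W.conductorNorm ℤ = D * M → Squarefree D → Even D.primeFactors.card →
          D.Coprime M → N₂ ≤ W.conductorNorm ℤ →
            Real.log (δ W D M) <
              (1 / 24 + ε) * (Nat.totient D : ℝ) * (M : ℝ) * Real.log (W.conductorNorm ℤ)) :
    pasten2024_height_lt := by
  -- the `D = 1` degree as a total function of the model (junk value `1` off conductor `≠ 0`)
  let δ₁ : WeierstrassCurve ℚ → ℝ := fun W ↦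
    if hN : W.conductorNorm ℤ = 0 then 1
    else (@minModularDegree W (W.conductorNorm ℤ) ⟨hN⟩ : ℝ)
  have hδ₁ : ∀ (W : WeierstrassCurve ℚ) [W.IsElliptic],
      ∃ _ : NeZero (W.conductorNorm ℤ), δ₁ W = (minModularDegree W (W.conductorNorm ℤ) : ℝ) := by
    intro W _
    have hN : W.conductorNorm ℤ ≠ 0 := (conductorNorm_pos_holds W).ne'
    exact ⟨⟨hN⟩, by simp only [δ₁, dif_neg hN]⟩
  refine pasten2024_height_lt_of_bounds_of_thm_7_2 δ₁ δ (2 * Real.pi - Real.log Real.pi / 2) B B'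
    (fun W _ _ L hL ↦ ?_) (fun W _ _ D M hN hD hDe hDM ↦ ?_) h72
  · obtain ⟨_, h⟩ := hδ₁ W
    rw [h]
    exact pasten2024_eq_3_4_of_modularity hmod W L hL
  · obtain ⟨_, h⟩ := hδ₁ W
    rw [h]
    exact h61 W D M hN hD hDe hDM

/-- **Thm 1.9 from modularity, Mazur–Kenku, Thm 6.1 on the optimal degree `δ_{1,N}`, and
Thm 7.2** — the same deduction with (EqHDeg) in its printed form
(`pasten2024_eq_3_4_classMinimal_of_modularity_of_mazurKenku`). Inputs: `hmod`
(`nonempty_modularParametrizationData`); `h163` (`PastenShimura2024_minimalDegree_le_163_mul`,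
Mazur–Kenku); `h61`, Thm 6.1, first display, with `δ_{1,N}` the modular degree of a datum `D₀` of
minimal degree in the class at level `N_W` (the idiom of `PastenShimura2024_thm_5_5`) and
`δ W D M = δ_{D,M}(E)` abstract; `h72`, Thm 7.2 (asymptotic clause).
[cite: PastenShimura2024, Thm 1.9 via §3 (EqHDeg), Thm 6.1, Thm 7.2, Thm 7.6, Thm 7.7, Cor 7.8] -/
theorem pasten2024_height_lt_of_modularity_of_mazurKenku_of_thm_6_1_of_thm_7_2
    (hmod : nonempty_modularParametrizationData)
    (h163 : PastenShimura2024_minimalDegree_le_163_mul)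
    (δ : WeierstrassCurve ℚ → ℕ → ℕ → ℝ) (B B' : ℝ)
    (h61 : ∀ (W : WeierstrassCurve ℚ) [W.IsElliptic] [W.IsGloballyMinimal]
      [NeZero (W.conductorNorm ℤ)] (W₀ : WeierstrassCurve ℚ) [W₀.IsElliptic]
      (D₀ : ModularParametrizationData W₀ (W.conductorNorm ℤ)), IsNewformOf W D₀.f →
      (∀ (W'' : WeierstrassCurve ℚ) [W''.IsElliptic]
          (D'' : ModularParametrizationData W'' (W.conductorNorm ℤ)),
          D''.f = D₀.f → D₀.modularDegree ≤ D''.modularDegree) →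
      ∀ D M : ℕ, W.conductorNorm ℤ = D * M → Squarefree D → Even D.primeFactors.card →
        D.Coprime M →
          Real.log (D₀.modularDegree : ℝ) ≤ Real.log (δ W D M) +
            Real.log (∏ p ∈ D.primeFactors, ((W.minimalDiscriminantNorm ℤ).factorization p : ℝ)) +
            B * D.primeFactors.card + B')
    (h72 : ∀ ε : ℝ, 0 < ε → ∃ N₂ : ℕ,
      ∀ (W : WeierstrassCurve ℚ) [W.IsElliptic],
        ∀ D M : ℕ, W.conductorNorm ℤ = D * M → Squarefree D → Even D.primeFactors.card →
          D.Coprime M → N₂ ≤ W.conductorNorm ℤ →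
            Real.log (δ W D M) <
              (1 / 24 + ε) * (Nat.totient D : ℝ) * (M : ℝ) * Real.log (W.conductorNorm ℤ)) :
    pasten2024_height_lt := by
  -- for an elliptic globally minimal `W`: the degree `d = δ_{1,N}` of a datum of minimal degree in
  -- the class of `W` (`exists_minimal_datum_in_class`), with its (EqHDeg)- and Thm 6.1-type bounds
  have hclass : ∀ W : WeierstrassCurve ℚ, W.IsElliptic ∧ W.IsGloballyMinimal →
      ∃ d : ℕ, (∀ L : PeriodPair, IsNeronLatticeOf (W.baseChange ℂ) L →
          neronLatticeHeight L ≤ Real.log (d : ℝ) / 2 + 9) ∧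
        ∀ D M : ℕ, W.conductorNorm ℤ = D * M → Squarefree D → Even D.primeFactors.card →
          D.Coprime M →
            Real.log (d : ℝ) ≤ Real.log (δ W D M) +
              Real.log (∏ p ∈ D.primeFactors, ((W.minimalDiscriminantNorm ℤ).factorization p : ℝ)) +
              B * D.primeFactors.card + B' := by
    rintro W ⟨hW, hWm⟩
    haveI : NeZero (W.conductorNorm ℤ) := ⟨(conductorNorm_pos_holds W).ne'⟩
    obtain ⟨D'⟩ := hmod W
    obtain ⟨W₀, hW₀, D₀, hf, hmin⟩ := exists_minimal_datum_in_class D'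
    have hfW : IsNewformOf W D₀.f := by rw [hf]; exact D'.isNewformOf
    exact ⟨D₀.modularDegree,
      fun L hL ↦ pasten2024_eq_3_4_classMinimal_of_modularity_of_mazurKenku hmod h163 W L hL D₀
        hfW hmin,
      fun D M hN hD hDe hDM ↦ h61 W W₀ D₀ hfW hmin D M hN hD hDe hDM⟩
  -- `δ_{1,N}` as a total function of the model (junk value `1` off the elliptic minimal models)
  let δ₁ : WeierstrassCurve ℚ → ℝ := fun W ↦
    if h : W.IsElliptic ∧ W.IsGloballyMinimal then ((hclass W h).choose : ℝ) else 1
  refine pasten2024_height_lt_of_bounds_of_thm_7_2 δ₁ δ 9 B B'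
    (fun W hW hWm L hL ↦ ?_) (fun W hW hWm D M hN hD hDe hDM ↦ ?_) h72
  · have h : W.IsElliptic ∧ W.IsGloballyMinimal := ⟨hW, hWm⟩
    have hδ : δ₁ W = ((hclass W h).choose : ℝ) := by simp only [δ₁, dif_pos h]
    rw [hδ]
    exact (hclass W h).choose_spec.1 L hL
  · have h : W.IsElliptic ∧ W.IsGloballyMinimal := ⟨hW, hWm⟩
    have hδ : δ₁ W = ((hclass W h).choose : ℝ) := by simp only [δ₁, dif_pos h]
    rw [hδ]
    exact (hclass W h).choose_spec.2 D M hN hD hDe hDM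

end Literature.NumberTheory.EllipticCurves.ModularForms
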